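import Literature.NumberTheory.GaloisRepresentations.Corestriction
import Literature.NumberTheory.GaloisRepresentations.ContinuousCorestriction
import Literature.NumberTheory.GaloisRepresentations.GaloisCohomologyCorestriction
import Literature.AnabelianGeometry.AbsoluteAnabelian.LocalResidueMapCorestriction
import Literature.AnabelianGeometry.AbsoluteAnabelian.LocalReciprocityVerlagerung
import HarnessLib

/-!
# The transfer corestriction `cores` (NSW I §5) IS the Shapiro corestriction `cor` (Serre I §2.5)
# in degree one; the field corestriction `Cor_{F'/F}` in Shapiro form

Topic `NumberTheory/GaloisRepresentations`; namespace `Literature.NumberTheory.GaloisRepresentations`.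
Definitions with bodies and theorems only; no named fact, no instance.

The tree carries two corestrictions on continuous cohomology of a profinite group `G` along an
open subgroup `S` of finite index:

* `cores X S hS : H¹(S, X) → H¹(G, X)` (`ContinuousCorestriction.lean`) — the explicit TRANSFER on
  continuous crossed homomorphisms, `(cor f)(g) = Σ_{x ∈ G/S} s(g·x) · f(s(g·x)⁻¹ g s(x))` for a system
  `s` of left-coset representatives (Neukirch–Schmidt–Wingberg I §5), degree `1` only, any topological
  coefficients; it is what the FIELD corestriction `galoisCohomology.cor` (`GaloisCohomologyCorestriction`)
  and the semi-local descent package of the `bsd-stepL` cell use;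
* `cor S ρ q : H^q(S, M) → H^q(G, M)` (`Corestriction.lean`) — Serre's construction through the
  Shapiro extension map and the norm `M_G^S(M) → M`, all degrees, discrete coefficients; it is what
  carries `Cor ∘ Res = (G : S)` in all degrees, the projection formula `cor (res a ∪ b) = a ∪ cor b`
  (`cor_cupProduct_resH`), the naturality `cor_cohomologyMap`, and `inv_F ∘ Cor_{E/F} = inv_E`
  (`Prop121vii.invLevel_corMu`).

This file proves that **they agree in degree one** (`cores_eq_cor`): unwinding the Shapiro extension
`ext(c)(g₀, g₁) = (x ↦ c(r(x g₀), r(x g₁)))` (`r : G → S` the chosen continuous `S`-equivariant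
retraction, `corRetraction`) and the norm `Σ_{γ ∈ G/S} γ̃ · F(γ̃⁻¹)` on the homogeneous `1`-cocycle
`(x, y) ↦ f(y) − f(x)` of a crossed homomorphism `f` gives EXACTLY the transfer of `f` for the system of
representatives `s(γ) := γ̃ · r(γ̃⁻¹)` (`shapiroSection`; the key identity is
`r(γ̃⁻¹ g) = r(γ̃⁻¹) · (s(γ)⁻¹ g s(g⁻¹γ))`, `corRetraction_inv_out_mul`), and `cores` does not depend on the
representatives (`coresWith_eq_cores`).

Consequences in the FIELD currency (a finite extension `F'/F` of fields of characteristic `0`,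
`ρ` a discrete `Γ_F`-module): with `S' = Gal(F̄/ι⁻¹F') ≤ Γ_F` (`LocalWeilDatum.galFixing F (embField F F')`,
equal to the range of `res : Γ_{F'} → Γ_F`, the tree's `galFixing_embField_eq_range`) and the lift
`Prop121vii.liftGalC F F' : S' →ₜ* Γ_{F'}`,
* `galoisCohomology.liftTransport ρ F' n : Hⁿ(F', M) →+ Hⁿ(S', M|_{S'})` (pull back along the lift,
  identity on `M`), `liftTransport_res : liftTransport (Res x) = resH S' x`;
* **`galoisCohomology.cor_eq_cor_liftTransport : Cor_{F'/F} y = cor S' ρ 1 (liftTransport y)`** — the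
  field corestriction in Shapiro form on the subgroup used by `Prop121vii.corMu` (so that the projection
  formula and `invLevel_corMu` become available to consumers of `galoisCohomology.cor`);
* the transport lemma behind it, `cor_map_eq_of_subgroup_eq` (equal subgroups, compatible pull-backs).

Consumer: the (adjoint) binder `⟨Res_{w/v} a, b'⟩_w = ⟨a, Cor^D_{w/v} b'⟩_v` of the prime-to-`p` descent of
Poitou–Tate middle-exactness (cell `bsd-stepL`, crux `ZhangSharpFrameAtThreeHL`).

## References

* J. Neukirch, A. Schmidt, K. Wingberg, *Cohomology of Number Fields*, 2nd ed. (2008), I §5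
  (corestriction on cochains via coset representatives, pp. 47–48). [NeukirchSchmidtWingberg2008]
* J.-P. Serre, *Galois Cohomology* (1997), I §2.4–§2.5 (Res, Cor via `M_G^S`, Prop. 9–10).
  [SerreGaloisCohomology1997]

## Tree search

`lean search 'cores_eq|coresWith.*cor|shapiroSection|liftTransport'`: no prior declaration; inputs
`cores`/`coresWith_eq_cores`/`transferFun` (ContinuousCorestriction), `cor`/`corCochains`/`corRetraction`
(Corestriction), `galoisCohomology.cor_eq_cores_rangeTransport` (GaloisCohomologyCorestriction),
`Prop121vii.liftGalC` (LocalResidueMapCorestriction), `galFixing_embField_eq_range`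
(LocalReciprocityVerlagerung: `Gal(F̄/ι⁻¹F') = range res`, reused, not restated).
-/

noncomputable section

open CategoryTheory Function

universe u

namespace Literature.NumberTheory.GaloisRepresentations

open _root_.TopRep _root_.ContRepresentation _root_.ContinuousCohomology
open Literature.NumberTheory.EllipticCurves (schreierElt schreierElt_mem schreierElt_coe)

set_option allowUnsafeReducibility true in
attribute [local reducible] CategoryTheory.Functor.mapHomologicalComplex

/-! ### The Shapiro corestriction in degree one is the transfer -/

section Compare

variable {G : Type u} [Group G] [TopologicalSpace G] [IsTopologicalGroup G] [CompactSpace G]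
  [T2Space G] [TotallyDisconnectedSpace G]
variable (S : Subgroup G) [hS : IsClosed (S : Set G)]
variable {M : Type u} [AddCommGroup M] [TopologicalSpace M] [DiscreteTopology M]
variable (ρ : ContinuousRep G ℤ M)

attribute [local instance] compactSpace_of_isClosed_subgroup discreteTopology_coind

/-- **The system of left-coset representatives of the Shapiro construction**: `s(γ) := γ̃ · r(γ̃⁻¹)`
with `γ̃ = γ.out` and `r = corRetraction S` the chosen continuous `S`-equivariant retraction `G → S`.
[cite: SerreGaloisCohomology1997, I §2.5] -/
def shapiroSection (γ : G ⧸ S) : G := γ.out * (corRetraction S γ.out⁻¹ : G)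

/-- `s(γ) ∈ γ`: `shapiroSection` is a system of representatives of `G/S`.
[cite: SerreGaloisCohomology1997, I §2.5] -/
theorem shapiroSection_spec (γ : G ⧸ S) : ((shapiroSection S γ : G) : G ⧸ S) = γ := by
  conv_rhs => rw [← QuotientGroup.out_eq' γ]
  rw [shapiroSection, eq_comm, QuotientGroup.eq, inv_mul_cancel_left]
  exact (corRetraction S γ.out⁻¹).2

/-- **The key identity `r(γ̃⁻¹ g) = r(γ̃⁻¹) · (s(γ)⁻¹ g s(g⁻¹γ))`** in `G` (from the `S`-equivariance
`r(t x) = t r(x)` applied to `t = (g⁻¹γ̃)⁻¹ · (g⁻¹γ)~ ∈ S`). [cite: SerreGaloisCohomology1997, I §2.5] -/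
theorem corRetraction_inv_out_mul (c : G ⧸ S) (g : G) :
    (corRetraction S (c.out⁻¹ * g) : G) =
      (corRetraction S c.out⁻¹ : G) * ((shapiroSection S c)⁻¹ * g * shapiroSection S (g⁻¹ • c)) := by
  set d : G := (g⁻¹ • c).out with hd
  have ht : (g⁻¹ * c.out)⁻¹ * d ∈ S := by
    rw [← QuotientGroup.eq, hd, QuotientGroup.out_eq']
    conv_rhs => rw [← QuotientGroup.out_eq' c]
    rfl
  have hd' : d⁻¹ = ((g⁻¹ * c.out)⁻¹ * d)⁻¹ * (c.out⁻¹ * g) := by group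
  have hr' : (corRetraction S d⁻¹ : G) =
      ((g⁻¹ * c.out)⁻¹ * d)⁻¹ * (corRetraction S (c.out⁻¹ * g) : G) := by
    have := corRetraction_mul S (((g⁻¹ * c.out)⁻¹ * d)⁻¹) (S.inv_mem ht) (c.out⁻¹ * g)
    rw [← hd'] at this
    exact this
  rw [shapiroSection, shapiroSection, ← hd, hr']
  group

/-- The Schreier element `s(γ)⁻¹ g s(g⁻¹γ)` of the section `s` lies in `S`.
[cite: NeukirchSchmidtWingberg2008, I §5] -/
theorem shapiroSchreier_mem (c : G ⧸ S) (g : G) :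
    (shapiroSection S c)⁻¹ * g * shapiroSection S (g⁻¹ • c) ∈ S := by
  have h := schreierElt_mem S (shapiroSection_spec S) g (g⁻¹ • c)
  rwa [smul_inv_smul] at h

/-- The key identity in `S`: `r(γ̃⁻¹ g) = r(γ̃⁻¹) · ⟨s(γ)⁻¹ g s(g⁻¹γ)⟩`.
[cite: SerreGaloisCohomology1997, I §2.5] -/
theorem corRetraction_inv_out_mul_eq (c : G ⧸ S) (g : G) :
    corRetraction S (c.out⁻¹ * g) =
      corRetraction S c.out⁻¹ * ⟨(shapiroSection S c)⁻¹ * g * shapiroSection S (g⁻¹ • c),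
        shapiroSchreier_mem S c g⟩ :=
  Subtype.ext (corRetraction_inv_out_mul S c g)

/-- **Per-term identity**: for a crossed homomorphism `f` on `S`,
`γ̃ · (f(r(γ̃⁻¹ g)) − f(r(γ̃⁻¹))) = s(γ) · f(s(γ)⁻¹ g s(g⁻¹γ))` (cocycle rule `f(ab) = f(a) + a f(b)`).
[cite: NeukirchSchmidtWingberg2008, I §5] -/
theorem out_smul_sub_eq_shapiroSection_smul (f : contOneCocycles (subgroupRep ρ.toTopRep S))
    (c : G ⧸ S) (g : G) :
    ρ c.out (f.1 (corRetraction S (c.out⁻¹ * g)) - f.1 (corRetraction S c.out⁻¹)) =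
      ρ (shapiroSection S c) (f.1 ⟨(shapiroSection S c)⁻¹ * g * shapiroSection S (g⁻¹ • c),
        shapiroSchreier_mem S c g⟩) := by
  rw [corRetraction_inv_out_mul_eq, f.2, add_sub_cancel_left]
  change ρ c.out (ρ (corRetraction S c.out⁻¹ : G) _) = _
  rw [← Module.End.mul_apply, ← map_mul]
  rfl

variable [Fintype (G ⧸ S)]

/-- **The corestriction cochain map in degree one, explicitly**:
`(cor c)(x, y) = Σ_{γ ∈ G/S} γ̃ · c(r(γ̃⁻¹ x), r(γ̃⁻¹ y))` (Shapiro extension `(x, y) ↦ (u ↦ c(r(u x), r(u y)))`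
followed by the norm `Σ_γ γ̃ F(γ̃⁻¹)`; definitional). [cite: SerreGaloisCohomology1997, I §2.5] -/
theorem corCochains_f_one_apply (σ : (homogeneousCochains (ρ.restrict (subgroupIncl S)).toTopRep).X 1)
    (x y : G) :
    (((corCochains S ρ).f 1 σ).1 : C(G, C(G, M))) x y =
      ∑ c : G ⧸ S, ρ c.out ((σ.1 : C(S, C(S, M))) (corRetraction S (c.out⁻¹ * x))
        (corRetraction S (c.out⁻¹ * y))) :=
  rfl

/-- **The transfer for the Shapiro section, in Shapiro form**:
`(cor_s f)(g) = Σ_{γ ∈ G/S} γ̃ · (f(r(γ̃⁻¹ g)) − f(r(γ̃⁻¹)))` (reindex `x = g⁻¹γ` and the per-term identity).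
[cite: NeukirchSchmidtWingberg2008, I §5] -/
theorem transferFun_shapiroSection (f : contOneCocycles (subgroupRep ρ.toTopRep S)) (g : G) :
    transferFun ρ.toTopRep S (shapiroSection_spec S) f g =
      ∑ c : G ⧸ S, ρ c.out (f.1 (corRetraction S (c.out⁻¹ * g)) - f.1 (corRetraction S c.out⁻¹)) := by
  rw [transferFun_apply]
  refine Fintype.sum_equiv (MulAction.toPerm g) _ _ fun z => ?_
  rw [out_smul_sub_eq_shapiroSection_smul, MulAction.toPerm_apply]
  have hsch : schreierElt S (shapiroSection_spec S) g z =
      ⟨(shapiroSection S (g • z))⁻¹ * g * shapiroSection S (g⁻¹ • g • z),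
        shapiroSchreier_mem S (g • z) g⟩ :=
    Subtype.ext (by
      change _ = (shapiroSection S (g • z))⁻¹ * g * shapiroSection S (g⁻¹ • g • z)
      rw [schreierElt_coe, inv_smul_smul])
  rw [hsch]
  rfl

/-- **The transfer corestriction `cores` equals the Shapiro corestriction `cor` in degree one.**
For an open subgroup `S` of finite index of a profinite group `G` and a discrete `G`-module `M`,
`cores = cor : H¹(S, M) → H¹(G, M)` (the Shapiro cochain map sends the homogeneous cocycle
`(x, y) ↦ f(y) − f(x)` of a crossed homomorphism `f` to that of its transfer for the section
`shapiroSection`; `cores` does not depend on the section).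
[cite: SerreGaloisCohomology1997, I §2.5] [cite: NeukirchSchmidtWingberg2008, I §5 (cor on cochains)] -/
theorem cores_eq_cor (hSo : IsOpen (S : Set G))
    (y : continuousCohomology 1 (subgroupRep ρ.toTopRep S)) :
    cores ρ.toTopRep S hSo y = cor S ρ 1 y := by
  obtain ⟨f, rfl⟩ := oneCocycleClass_surjective _ y
  rw [← coresWith_eq_cores ρ.toTopRep S hSo (shapiroSection_spec S), coresWith_oneCocycleClass]
  change _ = cor S ρ 1 (oneCocycleClass (ρ.restrict (subgroupIncl S)).toTopRep f)
  unfold oneCocycleClass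
  symm
  refine homologyMap_cxClass _ 1 2 up_nat_next_one _ _ _ _ (Subtype.ext ?_)
  ext x y
  change transferFun ρ.toTopRep S (shapiroSection_spec S) f y -
      transferFun ρ.toTopRep S (shapiroSection_spec S) f x =
    (((corCochains S ρ).f 1 (toOneCochain _ f)).1 : C(G, C(G, M))) x y
  rw [corCochains_f_one_apply, transferFun_shapiroSection, transferFun_shapiroSection,
    ← Finset.sum_sub_distrib]
  refine Finset.sum_congr rfl fun c _ => ?_
  rw [← map_sub]
  congr 1
  change _ = (f.1 _ - f.1 _)
  abel

/-! ### Transport of `cor` along an equality of subgroups -/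

omit [Fintype (G ⧸ S)] hS in
/-- **`cor` along equal subgroups agrees on compatible pull-backs.**  If `S₁ = S₂`, `e_i : S_i → H` agree on
elements, and the module maps `f_i : N → M` agree, then `cor_{S₁} (H^q(e₁, f₁) z) = cor_{S₂} (H^q(e₂, f₂) z)`
for every `z ∈ H^q(H, N)` (after substitution the two `Fintype (G ⧸ S_i)` instances are equal by
subsingleton-ness). [cite: SerreGaloisCohomology1997, I §2.5] -/
theorem cor_map_eq_of_subgroup_eq {S₁ S₂ : Subgroup G} (h : S₁ = S₂)
    [IsClosed (S₁ : Set G)] [IsClosed (S₂ : Set G)] [i₁ : Fintype (G ⧸ S₁)] [i₂ : Fintype (G ⧸ S₂)]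
    {H : Type u} [Group H] [TopologicalSpace H] [IsTopologicalGroup H]
    {N : Type u} [AddCommGroup N] [TopologicalSpace N] [DiscreteTopology N] (τ : ContinuousRep H ℤ N)
    (e₁ : S₁ →ₜ* H) (e₂ : S₂ →ₜ* H)
    (he : ∀ (g : G) (h₁ : g ∈ S₁) (h₂ : g ∈ S₂), e₁ ⟨g, h₁⟩ = e₂ ⟨g, h₂⟩)
    (f₁ : TopRep.res (e₁ : S₁ →* H) τ.toTopRep ⟶ (ρ.restrict (subgroupIncl S₁)).toTopRep)
    (f₂ : TopRep.res (e₂ : S₂ →* H) τ.toTopRep ⟶ (ρ.restrict (subgroupIncl S₂)).toTopRep)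
    (hf : ∀ y : N, (f₁.hom y : M) = f₂.hom y) (q : ℕ) (z : continuousCohomology q τ.toTopRep) :
    cor S₁ ρ q (ContinuousCohomology.map e₁ f₁ q z) =
      cor S₂ ρ q (ContinuousCohomology.map e₂ f₂ q z) := by
  subst h
  obtain rfl : e₁ = e₂ := ContinuousMonoidHom.ext fun g => he g g.2 g.2
  obtain rfl : f₁ = f₂ := TopRep.hom_ext (ContIntertwiningMap.ext (ContinuousLinearMap.ext fun y => hf y))
  obtain rfl : i₁ = i₂ := Subsingleton.elim _ _
  rfl

end Compare

/-! ### The field corestriction `Cor_{F'/F}` in Shapiro form -/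

section Field

open Literature.NumberTheory.GaloisRepresentations.LocalWeilDatum (galFixing embField
  absGaloisRestrict_mem_galFixing exists_absGaloisRestrict_eq)
open Literature.AnabelianGeometry.AbsoluteAnabelian (Prop121vii.liftGalC Prop121vii.absGaloisRestrict_liftGalC)
open Field

variable (F : Type u) [Field F] (F' : Type u) [Field F'] [Algebra F F']

variable {F} {M : Type u} [AddCommGroup M] [TopologicalSpace M] [DiscreteTopology M]
  (ρ : DiscreteGaloisModule F M)

/-- The module map (identity of `M`) from `Γ_{F'}` acting through `res`, pulled back along the lift
`Gal(F̄/ι⁻¹F') → Γ_{F'}`, to the subgroup representation of `Gal(F̄/ι⁻¹F')` (`res ∘ lift = incl`).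
[cite: SerreGaloisCohomology1997, I §2.4] -/
def liftTransportHom [Algebra.IsAlgebraic F F'] :
    TopRep.res (Prop121vii.liftGalC F F' : galFixing F (embField F F') →* absoluteGaloisGroup F')
        (DiscreteGaloisModule.toTopRep (ρ.restrictField F')) ⟶
      (ρ.restrict (subgroupIncl (galFixing F (embField F F')))).toTopRep :=
  TopRep.ofHom ⟨ContinuousLinearMap.id ℤ M, fun g => by
    ext m
    change (ρ.restrictField F') (Prop121vii.liftGalC F F' g) m = ρ (g : absoluteGaloisGroup F) m
    rw [GaloisRep.restrictField_apply, Prop121vii.absGaloisRestrict_liftGalC]⟩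

/-- **`Hⁿ(F', M) →+ Hⁿ(Gal(F̄/ι⁻¹F'), M|)`**: pull back along the lift `Gal(F̄/ι⁻¹F') ⥲ Γ_{F'}`
(identity on `M`) — the abstract layer `F'` identified with the subgroup layer of the Shapiro
corestriction `cor` / of `Prop121vii.corMu`. [cite: SerreGaloisCohomology1997, I §2.4] -/
def galoisCohomology.liftTransport [Algebra.IsAlgebraic F F'] (n : ℕ) :
    galoisCohomology (ρ.restrictField F') n →+
      continuousCohomology n (ρ.restrict (subgroupIncl (galFixing F (embField F F')))).toTopRep :=
  (ContinuousCohomology.map (Prop121vii.liftGalC F F') (liftTransportHom F' ρ) n).hom.toLinearMap.toAddMonoidHom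

/-- Unfolding `liftTransport`. [cite: SerreGaloisCohomology1997, I §2.4] -/
theorem galoisCohomology.liftTransport_apply [Algebra.IsAlgebraic F F'] (n : ℕ)
    (y : galoisCohomology (ρ.restrictField F') n) :
    galoisCohomology.liftTransport F' ρ n y =
      ContinuousCohomology.map (Prop121vii.liftGalC F F') (liftTransportHom F' ρ) n y :=
  rfl

/-- **`liftTransport (Res x) = res_{S'} x`**: restricting to `Γ_{F'}` and transporting to the subgroup
layer is the subgroup restriction `resH` (`res ∘ lift = incl`, `map_comp_apply_of`).
[cite: SerreGaloisCohomology1997, I §2.4] -/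
theorem galoisCohomology.liftTransport_res [Algebra.IsAlgebraic F F'] (n : ℕ) (x : galoisCohomology ρ n) :
    galoisCohomology.liftTransport F' ρ n (galoisCohomology.res ρ F' n x) =
      resH (galFixing F (embField F F')) ρ n x := by
  rw [galoisCohomology.liftTransport_apply]
  symm
  exact map_comp_apply_of (X := ρ.toTopRep) (Y := DiscreteGaloisModule.toTopRep (ρ.restrictField F'))
    (Z := (ρ.restrict (subgroupIncl (galFixing F (embField F F')))).toTopRep)
    (absGaloisRestrict F F') (Prop121vii.liftGalC F F')
    (subgroupIncl (galFixing F (embField F F')))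
    (fun g => (Prop121vii.absGaloisRestrict_liftGalC F F' g).symm)
    (TopRep.ofHom ⟨ContinuousLinearMap.id ℤ M, fun _ => rfl⟩) (liftTransportHom F' ρ)
    (𝟙 ((ρ.restrict (subgroupIncl (galFixing F (embField F F')))).toTopRep))
    (fun _ => rfl) n x

variable [CharZero F] [FiniteDimensional F F']

/-- **The field corestriction in Shapiro form**: `Cor_{F'/F} y = cor_{S'} (liftTransport y)` with
`S' = Gal(F̄/ι⁻¹F')` the subgroup of `Prop121vii.corMu` (transfer = Shapiro corestriction in degree one,
`cores_eq_cor`; the range of `res` equals `S'`, `galFixing_embField_eq_range`, and the two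
transports are compatible pull-backs, `cor_map_eq_of_subgroup_eq`; the equality of subgroups is the
tree's `galFixing_embField_eq_range`). This makes the projection formula
`cor_cupProduct_resH` and `Prop121vii.invLevel_corMu` available for `galoisCohomology.cor`.
[cite: SerreGaloisCohomology1997, I §2.5] -/
theorem galoisCohomology.cor_eq_cor_liftTransport
    [IsClosed ((galFixing F (embField F F') : Subgroup (absoluteGaloisGroup F)) : Set (absoluteGaloisGroup F))]
    [Fintype (absoluteGaloisGroup F ⧸ galFixing F (embField F F'))]
    (y : galoisCohomology (ρ.restrictField F') 1) :
    haveI : CompactSpace (absoluteGaloisGroup F) := absoluteGaloisGroup_compactSpace F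
    galoisCohomology.cor ρ F' y =
      GaloisRepresentations.cor (galFixing F (embField F F')) ρ 1
        (galoisCohomology.liftTransport F' ρ 1 y) := by
  haveI : CompactSpace (absoluteGaloisGroup F) := absoluteGaloisGroup_compactSpace F
  haveI : IsClosed (((absGaloisRestrict F F').range : Subgroup (absoluteGaloisGroup F)) :
      Set (absoluteGaloisGroup F)) :=
    Subgroup.isClosed_of_isOpen _ (isOpen_range_absGaloisRestrict F F')
  letI : Fintype (absoluteGaloisGroup F ⧸ (absGaloisRestrict F F').range) := Fintype.ofFinite _
  rw [galoisCohomology.cor_eq_cores_rangeTransport, galoisCohomology.rangeTransport_apply,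
    cores_eq_cor _ ρ (isOpen_range_absGaloisRestrict F F'), galoisCohomology.liftTransport_apply]
  refine cor_map_eq_of_subgroup_eq ρ
    (Literature.AnabelianGeometry.AbsoluteAnabelian.galFixing_embField_eq_range F F').symm _ _ _
    (fun g h₁ h₂ => absGaloisRestrict_injective F F' ?_) _ _ (fun _ => rfl) 1 y
  rw [Prop121vii.absGaloisRestrict_liftGalC]
  exact absGaloisRestrict_absGaloisRangeEquiv_symm F F' ⟨g, h₁⟩

end Field

end Literature.NumberTheory.GaloisRepresentations

end
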